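import Mathlib.Algebra.Order.Chebyshev
import Mathlib.Algebra.Order.BigOperators.Ring.Finset
import Mathlib.Tactic.Ring
import Mathlib.Tactic.Linarith
import HarnessLib

/-!
# The equality case of Cauchy–Schwarz against the all-ones vector: `#s · Σ d² = (Σ d)²` iff `d` is constant on `s`

Topic `Analysis/Convex` (classical inequalities, next to ★ `AlzerInequality`); namespace `Literature.Analysis.Convex`.  THEOREMS ONLY, Mathlib-only (no definition, no named
fact, no instance, no `sorry`).  Cell hodgecm-mathlib, d6 line, «(ii)-inst» (A-plan2 (g11) 2026-08-29T22:05:38Z): in the dimension identity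
`[Z:ℚ] · dim_ℚ (H u₀) = (dim V u₀)²` feeding (R-split) (★ `EndomorphismAlgebraFullOverCentralField`), the complex side reads
`#Σ · Σ_{σ ∈ Σ} d_σ² ≥ (Σ_σ d_σ)²` (Cauchy–Schwarz, Mathlib `sq_sum_le_card_mul_sum_sq`) with EQUALITY iff the block dimensions
`d_σ = dim π_σ^K` are constant on the `Aut(ℂ/ℚ)`-orbit `Σ` — which they are (semilinear transport along ★ (G4)
`AutComplexCentralIdempotentOrbit`).  This file is the arithmetic: the Lagrange identity
`Σ_i Σ_j (d_i − d_j)² = 2·(#s · Σ d² − (Σ d)²)` ([HardyLittlewoodPolya1952] §2.4 (2.4.2), Cauchy's inequality with its case of equality,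
Thm. 7), the equality `#s · Σ d² = (Σ d)²` for constant `d`, the converse over an ordered ring, and the `ℕ` forms.

CONTENT: `sum_sum_sub_sq_eq`, `card_mul_sum_sq_eq_sq_sum_of_forall_eq`, `card_mul_sum_sq_eq_sq_sum_iff_forall_eq` (ordered commutative
ring), `card_mul_sum_sq_eq_sq_sum_iff_forall_eq_nat`, `card_mul_sum_sq_eq_sq_sum_of_forall_eq_nat`, and the packaged «(ii)-inst» shapes
`mul_eq_sq_of_forall_eq_nat` / `forall_eq_of_mul_eq_sq_nat` (`z = #s`, `h = Σ d²`, `v = Σ d`, `d` constant ⇒ `z * h = v ^ 2`).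
HC_CM is proved only modulo the 7 printed citations until rung 0 closes; nothing here moves a book.

## References
* [HardyLittlewoodPolya1952] G. H. Hardy, J. E. Littlewood, G. Pólya, *Inequalities*, 2nd ed., CUP (1952), §2.4 Thm. 7 and (2.4.2)
  (Cauchy's inequality, Lagrange's identity, the case of equality).
* [Liu2021] Y. Liu, Camb. J. Math. **9** (2021), App. D (D.3) p. 133 (the consumer).
-/

set_option autoImplicit false

open Finset

namespace Literature.Analysis.Convex

variable {ι : Type*} (s : Finset ι)

/-- **Lagrange's identity against the all-ones vector**: `Σ_{i ∈ s} Σ_{j ∈ s} (d_i − d_j)² = 2 (#s · Σ d² − (Σ d)²)`.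
[cite: HardyLittlewoodPolya1952, §2.4 (2.4.2) and Thm. 7] -/
theorem sum_sum_sub_sq_eq {R : Type*} [CommRing R] (d : ι → R) :
    ∑ i ∈ s, ∑ j ∈ s, (d i - d j) ^ 2 = 2 * ((#s : R) * ∑ i ∈ s, d i ^ 2 - (∑ i ∈ s, d i) ^ 2) := by
  have h1 : ∀ i, ∑ j ∈ s, (d i - d j) ^ 2 = (#s : R) * d i ^ 2 - 2 * d i * (∑ j ∈ s, d j) + ∑ j ∈ s, d j ^ 2 := by
    intro i
    have e : ∀ j, (d i - d j) ^ 2 = d i ^ 2 - 2 * d i * d j + d j ^ 2 := fun j => by ring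
    simp only [e, sum_add_distrib, sum_sub_distrib, sum_const, nsmul_eq_mul, ← mul_sum]
  simp only [h1, sum_add_distrib, sum_sub_distrib, sum_const, nsmul_eq_mul, ← mul_sum, ← sum_mul]
  ring

/-- **`#s · Σ d² = (Σ d)²` when `d` is constant on `s`** (both sides are `#s² c²`). [cite: HardyLittlewoodPolya1952, §2.4 Thm. 7 (case of equality)] -/
theorem card_mul_sum_sq_eq_sq_sum_of_forall_eq {R : Type*} [CommSemiring R] (d : ι → R)
    (h : ∀ i ∈ s, ∀ j ∈ s, d i = d j) : (#s : R) * ∑ i ∈ s, d i ^ 2 = (∑ i ∈ s, d i) ^ 2 := by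
  rcases s.eq_empty_or_nonempty with rfl | ⟨i₀, hi₀⟩
  · simp
  · have hc : ∀ i ∈ s, d i = d i₀ := fun i hi => h i hi i₀ hi₀
    rw [sum_congr rfl fun i hi => by rw [hc i hi], sum_congr rfl hc, sum_const, sum_const, nsmul_eq_mul, nsmul_eq_mul]
    ring

/-- **The case of equality in Cauchy's inequality (all-ones vector), over an ordered commutative ring**:
`#s · Σ d² = (Σ d)² ↔ d` is constant on `s` (⟹: Lagrange's identity makes `Σ_i Σ_j (d_i − d_j)² = 0`, a sum of squares).
[cite: HardyLittlewoodPolya1952, §2.4 Thm. 7 (case of equality) with (2.4.2)] -/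
theorem card_mul_sum_sq_eq_sq_sum_iff_forall_eq {R : Type*} [CommRing R] [LinearOrder R] [IsStrictOrderedRing R] (d : ι → R) :
    (#s : R) * ∑ i ∈ s, d i ^ 2 = (∑ i ∈ s, d i) ^ 2 ↔ ∀ i ∈ s, ∀ j ∈ s, d i = d j := by
  refine ⟨fun heq i hi j hj => ?_, card_mul_sum_sq_eq_sq_sum_of_forall_eq s d⟩
  have hsum : ∑ i ∈ s, ∑ j ∈ s, (d i - d j) ^ 2 = 0 := by rw [sum_sum_sub_sq_eq, heq, sub_self, mul_zero]
  have hrow : ∀ i ∈ s, ∑ j ∈ s, (d i - d j) ^ 2 = 0 :=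
    (sum_eq_zero_iff_of_nonneg fun i _ => sum_nonneg fun j _ => sq_nonneg _).1 hsum
  have hij : (d i - d j) ^ 2 = 0 := (sum_eq_zero_iff_of_nonneg fun j _ => sq_nonneg _).1 (hrow i hi) j hj
  exact sub_eq_zero.1 (pow_eq_zero_iff two_ne_zero |>.1 hij)

/-- The `ℕ` form of the case of equality: `#s · Σ d² = (Σ d)² ↔ d` constant on `s` (read in `ℤ`).
[cite: HardyLittlewoodPolya1952, §2.4 Thm. 7 (case of equality)] -/
theorem card_mul_sum_sq_eq_sq_sum_iff_forall_eq_nat (d : ι → ℕ) :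
    #s * ∑ i ∈ s, d i ^ 2 = (∑ i ∈ s, d i) ^ 2 ↔ ∀ i ∈ s, ∀ j ∈ s, d i = d j := by
  have h := card_mul_sum_sq_eq_sq_sum_iff_forall_eq s (fun i => (d i : ℤ))
  simp only [Nat.cast_inj] at h
  rw [← h]
  constructor
  · intro heq
    exact_mod_cast heq
  · intro heq
    exact_mod_cast heq

/-- The `ℕ` form, forward direction. [cite: HardyLittlewoodPolya1952, §2.4 Thm. 7 (case of equality)] -/
theorem card_mul_sum_sq_eq_sq_sum_of_forall_eq_nat (d : ι → ℕ) (h : ∀ i ∈ s, ∀ j ∈ s, d i = d j) :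
    #s * ∑ i ∈ s, d i ^ 2 = (∑ i ∈ s, d i) ^ 2 :=
  (card_mul_sum_sq_eq_sq_sum_iff_forall_eq_nat s d).2 h

/-- **«(ii)-inst» packaged**: if `z = #Σ` (degree of the centre), `h = Σ_σ d_σ²` (dimension of the block algebra) and `v = Σ_σ d_σ`
(dimension of the block module) with `d` constant on `Σ`, then `z · h = v²` — the hypothesis of (R-split).
[cite: HardyLittlewoodPolya1952, §2.4 Thm. 7 (case of equality)] -/
theorem mul_eq_sq_of_forall_eq_nat (d : ι → ℕ) {z h v : ℕ} (hz : z = #s) (hh : h = ∑ i ∈ s, d i ^ 2)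
    (hv : v = ∑ i ∈ s, d i) (hd : ∀ i ∈ s, ∀ j ∈ s, d i = d j) : z * h = v ^ 2 := by
  subst hz hh hv
  exact card_mul_sum_sq_eq_sq_sum_of_forall_eq_nat s d hd

/-- Conversely the identity FORCES constancy (the kill criterion: unequal block dimensions contradict `z · h = v²`).
[cite: HardyLittlewoodPolya1952, §2.4 Thm. 7 (case of equality)] -/
theorem forall_eq_of_mul_eq_sq_nat (d : ι → ℕ) {z h v : ℕ} (hz : z = #s) (hh : h = ∑ i ∈ s, d i ^ 2)
    (hv : v = ∑ i ∈ s, d i) (heq : z * h = v ^ 2) : ∀ i ∈ s, ∀ j ∈ s, d i = d j := by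
  subst hz hh hv
  exact (card_mul_sum_sq_eq_sq_sum_iff_forall_eq_nat s d).1 heq

end Literature.Analysis.Convex
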